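import Mathlib

/-!
# (W2) THE TELESCOPING BUDGET LEMMA (nsreg-p2 g36 ROUND-46 «THE KINEMATIC CEILING» §1, plate t48-W2)

Width piece for crux `EulerZoomLiouville.PowerGaugeEulerLiouville` (stmt-NavierStokesRegularity-19832), by name under LEAD 19832
(ns-typeII-p2 g13); seat ns-sfl-p1 g7, `--supports stmt-NavierStokesRegularity-19832 --as helper`.  Text = nsreg-p2 g36's
`r46/Sketch46.lean` (sha16 7c4c548940e39666) Prop `NsregP2.R46.TelescopingBudget` binder-for-binder.

Real inequalities only: if `F ≥ 0` on `[L₀, ∞)`, `F(t) ≤ C t^{1−ρ}` there, and every window pays `F(qℓ) − F(ℓ) ≥ a ℓ^{1−ρ}`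
(`ℓ ≥ L₀`, `q > 1`, `ρ < 1`, `L₀ > 0`), then `a ≤ C (q^{1−ρ} − 1)`.
Proof: with `Q = q^{1−ρ} > 1`, telescoping along `ℓ_j = qʲL₀` and the geometric sum give
`a L₀^{1−ρ}(Qⁿ − 1) ≤ (Q − 1)(F(qⁿL₀) − F(L₀)) ≤ (Q − 1) C Qⁿ L₀^{1−ρ}`, i.e. `(a − C(Q−1)) Qⁿ ≤ a` for every `n`; since `Qⁿ → ∞`
this forces `a ≤ C(Q − 1)`.  This is the bookkeeping step of THEOREM K″ (`NsregP2.R46.ThinWindowGapLiouville`): per-window Dirichlet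
costs `∝ ℓ^{1−ρ}` cannot be paid from a total budget `C_E t^{1−ρ}` unless the per-window constant is `≤ C_E(q^{1−ρ} − 1)`.

HONEST FRAMING: one-variable real analysis; nothing here proves the crux E (19832 OPEN), any door Target, or any Navier–Stokes
statement; MODEL lattice only. [folklore (telescoping, geometric series)]
-/

noncomputable section

open Set Filter Topology Real

set_option linter.dupNamespace false

namespace Summit.NavierStokesRegularity.NavierStokesRegularity.Theorems.PowerGaugeEulerLiouville.Condenser

/-- **(W2) THE TELESCOPING BUDGET LEMMA.**  See the module docstring. [folklore (telescoping, geometric series)] -/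
theorem telescopingBudget_of {F : ℝ → ℝ} {ρ C a q L₀ : ℝ} (hρ : ρ < 1) (hq : 1 < q) (hL₀ : 0 < L₀)
    (hF0 : ∀ t, L₀ ≤ t → 0 ≤ F t) (hFC : ∀ t, L₀ ≤ t → F t ≤ C * t ^ (1 - ρ))
    (hwin : ∀ ℓ, L₀ ≤ ℓ → a * ℓ ^ (1 - ρ) ≤ F (q * ℓ) - F ℓ) :
    a ≤ C * (q ^ (1 - ρ) - 1) := by
  set β : ℝ := 1 - ρ with hβ
  have hβpos : 0 < β := by rw [hβ]; linarith
  have hq0 : 0 < q := by linarith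
  set Q : ℝ := q ^ β with hQ
  have hQ1 : 1 < Q := by rw [hQ]; exact Real.one_lt_rpow hq hβpos
  have hQ0 : 0 < Q := by linarith
  have hL₀β : 0 < L₀ ^ β := Real.rpow_pos_of_pos hL₀ β
  -- `C ≥ 0` (from `0 ≤ F L₀ ≤ C L₀^β`)
  have hC0 : 0 ≤ C := by
    have h1 : 0 ≤ C * L₀ ^ β := (hF0 L₀ le_rfl).trans (hFC L₀ le_rfl)
    by_contra hC
    have : C * L₀ ^ β < 0 := mul_neg_of_neg_of_pos (not_le.1 hC) hL₀β
    linarith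
  -- the scales `ℓ_n = qⁿ L₀`
  have hℓn : ∀ n : ℕ, L₀ ≤ q ^ n * L₀ := fun n => le_mul_of_one_le_left hL₀.le (one_le_pow₀ hq.le)
  have hpowβ : ∀ n : ℕ, (q ^ n * L₀) ^ β = Q ^ n * L₀ ^ β := by
    intro n
    rw [Real.mul_rpow (pow_nonneg hq0.le n) hL₀.le, hQ, ← Real.rpow_natCast, ← Real.rpow_natCast,
      ← Real.rpow_mul hq0.le, ← Real.rpow_mul hq0.le, mul_comm (n : ℝ) β]
  -- telescoping: `a L₀^β Σ_{j<n} Qʲ ≤ F(qⁿL₀) − F(L₀)`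
  have htel : ∀ n : ℕ, a * L₀ ^ β * (∑ j ∈ Finset.range n, Q ^ j) ≤ F (q ^ n * L₀) - F L₀ := by
    intro n
    induction n with
    | zero => simp
    | succ n ih =>
      have hstep := hwin (q ^ n * L₀) (hℓn n)
      rw [hpowβ n] at hstep
      have e1 : q * (q ^ n * L₀) = q ^ (n + 1) * L₀ := by rw [pow_succ]; ring
      rw [e1] at hstep
      rw [Finset.sum_range_succ]
      have e2 : a * L₀ ^ β * (∑ j ∈ Finset.range n, Q ^ j + Q ^ n) =
          a * L₀ ^ β * (∑ j ∈ Finset.range n, Q ^ j) + a * (Q ^ n * L₀ ^ β) := by ring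
      rw [e2]
      linarith
  -- per `n`: `a (Qⁿ − 1) ≤ C (Q − 1) Qⁿ`
  have hmain : ∀ n : ℕ, a * (Q ^ n - 1) ≤ C * (Q - 1) * Q ^ n := by
    intro n
    have h1 := htel n
    have h2 : F (q ^ n * L₀) - F L₀ ≤ C * (Q ^ n * L₀ ^ β) := by
      have := hFC (q ^ n * L₀) (hℓn n)
      rw [hpowβ n] at this
      linarith [hF0 L₀ le_rfl]
    have h3 : a * L₀ ^ β * (∑ j ∈ Finset.range n, Q ^ j) * (Q - 1) ≤ C * (Q ^ n * L₀ ^ β) * (Q - 1) :=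
      mul_le_mul_of_nonneg_right (h1.trans h2) (by linarith)
    have e : a * L₀ ^ β * (∑ j ∈ Finset.range n, Q ^ j) * (Q - 1) = a * (Q ^ n - 1) * L₀ ^ β := by
      rw [mul_assoc, geom_sum_mul]; ring
    rw [e] at h3
    have h4 : a * (Q ^ n - 1) * L₀ ^ β ≤ (C * (Q - 1) * Q ^ n) * L₀ ^ β := by linarith
    exact le_of_mul_le_mul_right h4 hL₀β
  -- conclusion: otherwise `(a − C(Q−1)) Qⁿ ≤ a` contradicts `Qⁿ → ∞`
  by_contra hcon
  have hd : 0 < a - C * (Q - 1) := by linarith [not_le.1 hcon]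
  obtain ⟨n, hn⟩ := pow_unbounded_of_one_lt (a / (a - C * (Q - 1))) hQ1
  have h1 := hmain n
  have h2 : (a - C * (Q - 1)) * Q ^ n ≤ a := by nlinarith [h1]
  have h3 : a < (a - C * (Q - 1)) * Q ^ n := by
    rw [div_lt_iff₀ hd] at hn
    linarith
  linarith

/-- **`NsregP2.R46.TelescopingBudget`, binder-for-binder** (Sketch46 of nsreg-p2 g36, sha16 7c4c548940e39666, plate t48-W2).
[folklore (telescoping, geometric series)] -/
theorem telescopingBudget :
    ∀ (F : ℝ → ℝ) (ρ C a q L₀ : ℝ), ρ < 1 → 1 < q → 0 < L₀ →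
      (∀ t, L₀ ≤ t → 0 ≤ F t) → (∀ t, L₀ ≤ t → F t ≤ C * t ^ (1 - ρ)) →
      (∀ ℓ, L₀ ≤ ℓ → a * ℓ ^ (1 - ρ) ≤ F (q * ℓ) - F ℓ) →
      a ≤ C * (q ^ (1 - ρ) - 1) :=
  fun _ _ _ _ _ _ hρ hq hL₀ hF0 hFC hwin => telescopingBudget_of hρ hq hL₀ hF0 hFC hwin

end Summit.NavierStokesRegularity.NavierStokesRegularity.Theorems.PowerGaugeEulerLiouville.Condenser

end
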